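import Literature.Algebra.GroupRings.NilLeftIdealsInvolution
import Mathlib.RingTheory.Noetherian.Basic
import Mathlib.RingTheory.Artinian.Module
import HarnessLib

/-!
# `kG ≅ (kG)ᵒᵖ` by `g ↦ g⁻¹`, and Lam §6 Exercise 6.10: left noetherian (artinian) group rings are right noetherian (artinian)

[cite: Lam2001FirstCourse, §6 Exercise 6.10, p. 99; §6 p. 84 (the involution `(Σ α_g g)* = Σ ᾱ_g g⁻¹`)]

Lam, *A First Course in Noncommutative Rings*, Exercises for §6 (p. 99; p0111 of the held scan):

**Ex. 6.10.** Let `k` be a commutative ring and `G` be any group. If `kG` is left noetherian (resp. left artinian), show that `kG` is right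
noetherian (resp. right artinian).

The reason is the anti-automorphism `Σ a_g g ↦ Σ a_g g⁻¹` of `kG` (`k` commutative), i.e. a ring isomorphism `kG ≅ (kG)ᵒᵖ`, which
exchanges left and right ideals. More generally, for ANY ring `k` with an involution `*`, the involution `α ↦ α*` of `kG` of §6 p. 84
(the tree's `starGroupRing`, file `NilLeftIdealsInvolution`, with `(αβ)* = β*α*`) is such an isomorphism.

* §1 `starOpRingEquiv : kG ≃+* (kG)ᵐᵒᵖ`, `α ↦ op(α*)`, for `k` a ring with involution; `opRingEquivOfComm` the case of a commutative
  `k` with the identity involution (`Σ a_g g ↦ Σ a_g g⁻¹`).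
* §2 **Ex. 6.10**: for `k` commutative (indeed for any `k` with involution), `kG` left noetherian ⟹ `(kG)ᵒᵖ` left noetherian, i.e. `kG`
  right noetherian — both as `IsNoetherianRing (kG)ᵐᵒᵖ` and in Mathlib's right-module form `IsNoetherian (kG)ᵐᵒᵖ (kG)` — and the same
  for artinian; with the converses (the situation is symmetric), as `iff`s.

## References

* [Lam2001FirstCourse] T. Y. Lam, *A First Course in Noncommutative Rings*, 2nd ed., Graduate Texts in Mathematics 131, Springer, 2001,
  §6 p. 84 and Exercise 6.10 p. 99 (held scan `book:lamnd-first-course-noncommutative-rings`, p0096, p0111).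
-/

universe u w

namespace Literature.Algebra.GroupRings

open MonoidAlgebra MulOpposite

/-! ## §1 The anti-automorphism `α ↦ α*` as a ring isomorphism `kG ≅ (kG)ᵒᵖ` -/

section Star

variable (k : Type u) [Ring k] [StarRing k] (G : Type w) [Group G]

/-- **`kG ≅ (kG)ᵒᵖ`, `α ↦ α*`**: the involution `(Σ α_g g)* = Σ α_g* g⁻¹` is additive, bijective (`α** = α`) and reverses products,
so it is a ring isomorphism onto the opposite ring. [cite: Lam2001FirstCourse, §6 p. 84 («this gives an involution on `kG`»); Exercise 6.10] -/
noncomputable def starOpRingEquiv : MonoidAlgebra k G ≃+* (MonoidAlgebra k G)ᵐᵒᵖ where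
  toFun α := op (starGroupRing α)
  invFun β := starGroupRing (unop β)
  left_inv α := by simp only [unop_op, starGroupRing_starGroupRing]
  right_inv β := by simp only [starGroupRing_starGroupRing, op_unop]
  map_mul' α β := by rw [starGroupRing_mul, op_mul]
  map_add' α β := by rw [starGroupRing_add, op_add]

/-- [cite: Lam2001FirstCourse, §6 p. 84] -/
theorem starOpRingEquiv_apply (α : MonoidAlgebra k G) : starOpRingEquiv k G α = op (starGroupRing α) := rfl

/-- [cite: Lam2001FirstCourse, §6 p. 84] -/
theorem starOpRingEquiv_symm_apply (β : (MonoidAlgebra k G)ᵐᵒᵖ) : (starOpRingEquiv k G).symm β = starGroupRing (unop β) := rfl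

/-- On monomials: `a g ↦ op(a* g⁻¹)`. [cite: Lam2001FirstCourse, §6 p. 84] -/
theorem starOpRingEquiv_single (g : G) (a : k) : starOpRingEquiv k G (single g a) = op (single g⁻¹ (star a)) := by
  rw [starOpRingEquiv_apply, starGroupRing_single]

end Star

section Comm

variable (k : Type u) [CommRing k] (G : Type w) [Group G]

/-- **For a commutative ring `k`: `kG ≅ (kG)ᵒᵖ`, `Σ a_g g ↦ Σ a_g g⁻¹`** (the identity of `k` is an involution).
[cite: Lam2001FirstCourse, §6 Exercise 6.10; p. 84 («if `k` is a commutative ring, the identity map … gives an involution on `k`»)] -/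
noncomputable def opRingEquivOfComm : MonoidAlgebra k G ≃+* (MonoidAlgebra k G)ᵐᵒᵖ :=
  letI : StarRing k := starRingOfComm
  starOpRingEquiv k G

/-- On monomials: `a g ↦ op(a g⁻¹)`. [cite: Lam2001FirstCourse, §6 Exercise 6.10] -/
theorem opRingEquivOfComm_single (g : G) (a : k) : opRingEquivOfComm k G (single g a) = op (single g⁻¹ a) := by
  letI : StarRing k := starRingOfComm
  exact starOpRingEquiv_single k G g a

/-- Coefficients: `(unop (φ α))_g = α_{g⁻¹}`. [cite: Lam2001FirstCourse, §6 Exercise 6.10] -/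
theorem coeff_unop_opRingEquivOfComm (α : MonoidAlgebra k G) (g : G) : (unop (opRingEquivOfComm k G α)).coeff g = α.coeff g⁻¹ := by
  letI : StarRing k := starRingOfComm
  change (starGroupRing α).coeff g = α.coeff g⁻¹
  rw [coeff_starGroupRing]
  rfl

end Comm

/-! ## §2 Exercise 6.10 -/

section RightModule

variable {R : Type u} [Ring R]

/-- The right regular module `R_R` (Mathlib: `R` as a module over `Rᵐᵒᵖ`) is the left regular module of `Rᵐᵒᵖ`, along `op`. [folklore] -/
private def opLinearEquivSelf : R ≃ₗ[Rᵐᵒᵖ] Rᵐᵒᵖ :=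
  { MulOpposite.opAddEquiv with
    map_smul' := fun r x ↦ by
      change op (x * unop r) = r * op x
      rw [op_mul, op_unop] }

/-- `Rᵒᵖ` left noetherian ⟹ `R` right noetherian (`R_R` noetherian). [folklore] -/
private theorem isNoetherian_op_self [IsNoetherianRing Rᵐᵒᵖ] : IsNoetherian Rᵐᵒᵖ R :=
  isNoetherian_of_linearEquiv (opLinearEquivSelf (R := R)).symm

/-- `R` right noetherian ⟹ `Rᵒᵖ` left noetherian. [folklore] -/
private theorem isNoetherianRing_op_of_isNoetherian_op_self [IsNoetherian Rᵐᵒᵖ R] : IsNoetherianRing Rᵐᵒᵖ :=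
  isNoetherian_of_linearEquiv (opLinearEquivSelf (R := R))

/-- `Rᵒᵖ` left artinian ⟹ `R` right artinian. [folklore] -/
private theorem isArtinian_op_self [IsArtinianRing Rᵐᵒᵖ] : IsArtinian Rᵐᵒᵖ R :=
  isArtinian_of_linearEquiv (opLinearEquivSelf (R := R)).symm

/-- `R` right artinian ⟹ `Rᵒᵖ` left artinian. [folklore] -/
private theorem isArtinianRing_op_of_isArtinian_op_self [IsArtinian Rᵐᵒᵖ R] : IsArtinianRing Rᵐᵒᵖ :=
  isArtinian_of_linearEquiv (opLinearEquivSelf (R := R))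

end RightModule

section Lam610

variable (k : Type u) [CommRing k] (G : Type w) [Group G]

/-- **LAM Exercise 6.10 (noetherian): for `k` commutative and any group `G`, if `kG` is left noetherian then `(kG)ᵒᵖ` is left
noetherian, i.e. `kG` is right noetherian.** [cite: Lam2001FirstCourse, §6 Exercise 6.10] -/
theorem isNoetherianRing_mulOpposite [IsNoetherianRing (MonoidAlgebra k G)] : IsNoetherianRing (MonoidAlgebra k G)ᵐᵒᵖ :=
  isNoetherianRing_of_ringEquiv _ (opRingEquivOfComm k G)

/-- **LAM Exercise 6.10 (noetherian), right-module form: `kG` left noetherian ⟹ the right regular module `kG_{kG}` is noetherian.**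
[cite: Lam2001FirstCourse, §6 Exercise 6.10] -/
theorem isNoetherian_mulOpposite_self [IsNoetherianRing (MonoidAlgebra k G)] :
    IsNoetherian (MonoidAlgebra k G)ᵐᵒᵖ (MonoidAlgebra k G) :=
  haveI := isNoetherianRing_mulOpposite k G
  isNoetherian_op_self

/-- **Exercise 6.10, symmetric form: `kG` is left noetherian iff it is right noetherian** (`k` commutative).
[cite: Lam2001FirstCourse, §6 Exercise 6.10] -/
theorem isNoetherianRing_iff_isNoetherian_mulOpposite :
    IsNoetherianRing (MonoidAlgebra k G) ↔ IsNoetherian (MonoidAlgebra k G)ᵐᵒᵖ (MonoidAlgebra k G) := by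
  refine ⟨fun _ ↦ isNoetherian_mulOpposite_self k G, fun _ ↦ ?_⟩
  haveI : IsNoetherianRing (MonoidAlgebra k G)ᵐᵒᵖ := isNoetherianRing_op_of_isNoetherian_op_self
  exact isNoetherianRing_of_ringEquiv _ (opRingEquivOfComm k G).symm

/-- **LAM Exercise 6.10 (artinian): for `k` commutative and any group `G`, if `kG` is left artinian then `(kG)ᵒᵖ` is left artinian,
i.e. `kG` is right artinian.** [cite: Lam2001FirstCourse, §6 Exercise 6.10] -/
theorem isArtinianRing_mulOpposite [IsArtinianRing (MonoidAlgebra k G)] : IsArtinianRing (MonoidAlgebra k G)ᵐᵒᵖ :=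
  (opRingEquivOfComm k G).isArtinianRing

/-- **LAM Exercise 6.10 (artinian), right-module form: `kG` left artinian ⟹ `kG_{kG}` artinian.** [cite: Lam2001FirstCourse, §6
Exercise 6.10] -/
theorem isArtinian_mulOpposite_self [IsArtinianRing (MonoidAlgebra k G)] :
    IsArtinian (MonoidAlgebra k G)ᵐᵒᵖ (MonoidAlgebra k G) :=
  haveI := isArtinianRing_mulOpposite k G
  isArtinian_op_self

/-- **Exercise 6.10, symmetric form: `kG` is left artinian iff it is right artinian** (`k` commutative).
[cite: Lam2001FirstCourse, §6 Exercise 6.10] -/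
theorem isArtinianRing_iff_isArtinian_mulOpposite :
    IsArtinianRing (MonoidAlgebra k G) ↔ IsArtinian (MonoidAlgebra k G)ᵐᵒᵖ (MonoidAlgebra k G) := by
  refine ⟨fun _ ↦ isArtinian_mulOpposite_self k G, fun _ ↦ ?_⟩
  haveI : IsArtinianRing (MonoidAlgebra k G)ᵐᵒᵖ := isArtinianRing_op_of_isArtinian_op_self
  exact (opRingEquivOfComm k G).symm.isArtinianRing

end Lam610

/-! ## §3 The same over any coefficient ring with involution -/

section StarNoetherian

variable (k : Type u) [Ring k] [StarRing k] (G : Type w) [Group G]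

/-- For any coefficient ring `k` with an involution (e.g. `ℂ`, or a commutative ring): `kG` left noetherian ⟹ `kG` right noetherian.
[cite: Lam2001FirstCourse, §6 Exercise 6.10 and p. 84] -/
theorem isNoetherian_mulOpposite_self_of_star [IsNoetherianRing (MonoidAlgebra k G)] :
    IsNoetherian (MonoidAlgebra k G)ᵐᵒᵖ (MonoidAlgebra k G) :=
  haveI : IsNoetherianRing (MonoidAlgebra k G)ᵐᵒᵖ := isNoetherianRing_of_ringEquiv _ (starOpRingEquiv k G)
  isNoetherian_op_self

/-- For any coefficient ring `k` with an involution: `kG` left artinian ⟹ `kG` right artinian. [cite: Lam2001FirstCourse, §6 Exercise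
6.10 and p. 84] -/
theorem isArtinian_mulOpposite_self_of_star [IsArtinianRing (MonoidAlgebra k G)] :
    IsArtinian (MonoidAlgebra k G)ᵐᵒᵖ (MonoidAlgebra k G) :=
  haveI : IsArtinianRing (MonoidAlgebra k G)ᵐᵒᵖ := (starOpRingEquiv k G).isArtinianRing
  isArtinian_op_self

end StarNoetherian

end Literature.Algebra.GroupRings
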